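import Summits.AtomisticToContinuum.HydrodynamicLimit.Theorems.JParityClosureCollisionTightnessGibbsWindow
import Summits.AtomisticToContinuum.HydrodynamicLimit.Theorems.JParityClosureOddContactSymmetryGibbsInvariance
import HarnessLib

/-!
# `JParityClosure.CollisionTightness` (stmt-AtomisticToContinuum-13085), rung 0:
# collision tightness under the homogeneous (flow-invariant) Gibbs law

Helper file (`--supports stmt-AtomisticToContinuum-13085`).  The constant-profile instance of the
route's support item `CollisionTightness` is PROVED (`collisionTightness_const`): for activity
`a > 0`, drift `ū`, temperature `θ > 0`, every `0 < σ < 1/4`, every family of hard-sphere flows `Φ_N`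
(the hypothesis structure `HardSphereFlow` on `𝕋³`), every `τ > 0` and `δ > 0` there is `K` with
`G_N{z | K < ε_N (N+1)⁻¹ · #{collision times of the orbit of z in [0, τ]}} ≤ δ` for every `N`,
`G_N = localGibbsLaw σ a ū θ N Φ_N`.  In fact `E[#collisions in [0,τ]] ≤ 16 (N+1)² ε_N² τ E_γ‖w−ū‖`
(the mean-free-time bound of the dilute hard-sphere gas on the torus), and Markov's inequality with
`(N+1) ε_N³ = σ³` gives `K = O(σ³ τ / δ)` uniformly in `N`.

* `exists_collision_majorant` — cover `[0, τ]` by `2^m` windows; by `exists_windowSet` and the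
  invariance of `G_N` under every `Φ_t` (`localGibbsLaw_const_preimage_flow`) the expected number of
  windows containing a collision is `≤ R = 16(N+1)²ε²τ E‖w−ū‖` uniformly in `m`; on every good orbit
  the number of occupied windows is eventually at least the (finite) number of collision times, so
  `F := liminf` of the window counts is a measurable majorant of the collision count with `∫ F ≤ R`
  (Fatou);
* `lintegral_numCollisions_le_const` — **the mean collision number** `∫ #collisions dG_N ≤ R`;
* `collisionTightness_const` — Markov's inequality for `F` and `(N+1) ε_N³ = σ³`.

The item as filed (LOCAL Gibbs data with non-constant continuous profiles) is not settled by this: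
see `JParityClosureCollisionTightnessDomination` (the transfer from `G_N` to a local Gibbs law costs
`Λ^{N+1}` and would need speed-`N` large-deviation bounds for the equilibrium collision count) and
the evidence memo on the item.

References: N. Chernov, *Entropy, Lyapunov exponents, and mean free path for billiards*,
J. Stat. Phys. 88 (1997) 1–29; C. Cercignani, R. Illner, M. Pulvirenti (1994), App. 4.A;
H. Spohn (1991), Part I §2.3.
-/

noncomputable section

open MeasureTheory Set Filter Topology
open scoped ENNReal InnerProductSpace

namespace Summit.AtomisticToContinuum.HydrodynamicLimit.Theorems

open Literature.Analysis.FluidPDE Literature.MathematicalPhysics.KineticTheory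
open Literature.Analysis.FunctionSpaces

/-! ### Rung 0: collision tightness under the homogeneous Gibbs law -/

/-- The first absolute moment of the Gaussian `N(ū, θ)` is finite. [folklore] -/
theorem lintegral_enorm_sub_gaussMeasure_lt_top (ubar : V3) (θ : ℝ) :
    ∫⁻ w, ‖w - ubar‖ₑ ∂gaussMeasure ubar θ < ⊤ := by
  have hint : Integrable (fun w : V3 => w - ubar) (gaussMeasure ubar θ) :=
    ((ProbabilityTheory.IsGaussian.memLp_id (gaussMeasure ubar θ) 1 (by simp)).integrable le_rfl).sub
      (integrable_const ubar)
  exact hint.2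

/-- **A measurable majorant of the collision count with controlled Gibbs mean.** Under the
homogeneous Gibbs law `G_N = localGibbsLaw σ a ū θ N Φ` (`a, θ > 0`, `0 < σ ≤ 1/4`), for every
hard-sphere flow `Φ` and horizon `τ > 0` there is a measurable `F ≥ #{collision times in [0, τ]}` on
the good set with `∫ F dG_N ≤ 16 (N+1)² ε_N² τ · E_γ‖w − ū‖`.  Proof: cover `[0, τ]` by `2^m`
windows; a collision in a window puts the window's initial configuration in the window set
(`exists_freeFlight_contact_of_collision_shift`, `exists_windowSet`), whose probability is the same at
every window start by invariance (`localGibbsLaw_const_preimage_flow`); so the expected number of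
occupied windows is `≤ 2^m · 16(N+1)²ε²(τ/2^m)·E‖w−ū‖ = R` uniformly in `m`; on every good orbit the
number of occupied windows is eventually at least the (finite) number of collision times (positive
gap between them), and `F := liminf_m` of the window counts has `∫ F ≤ R` by Fatou. [folklore] -/
theorem exists_collision_majorant {a θ : ℝ} (ha : 0 < a) (hθ : 0 < θ) (ubar : V3) {σ : ℝ}
    (hσ : 0 < σ) (hσ4 : σ ≤ 1 / 4) (N : ℕ)
    (Φ : HardSphereFlow (Torus.geometry (Fin 3)) (hsDiameter σ N) (N + 1)) {τ : ℝ} (hτ : 0 < τ) :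
    ∃ F : Config (N + 1) (Fin 3) T3 → ℝ≥0∞, Measurable F ∧
      (∀ z ∈ Φ.good, ((numCollisions (Torus.geometry (Fin 3)) (hsDiameter σ N)
        (fun s => Φ.flow s z) 0 τ : ℕ) : ℝ≥0∞) ≤ F z) ∧
      ∫⁻ z, F z ∂(localGibbsLaw σ (fun _ => a) (fun _ => ubar) (fun _ => θ) N Φ) ≤
        ENNReal.ofReal (16 * ((N : ℝ) + 1) ^ 2 * (hsDiameter σ N) ^ 2 * τ) *
          ∫⁻ w, ‖w - ubar‖ₑ ∂gaussMeasure ubar θ := by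
  set m₁ : ℝ≥0∞ := ∫⁻ w, ‖w - ubar‖ₑ ∂gaussMeasure ubar θ with hm₁
  have hε0 : 0 < (hsDiameter σ N) := hsDiameter_pos hσ N
  set P := localGibbsLaw σ (fun _ => a) (fun _ => ubar) (fun _ => θ) N Φ with hP
  have hPeq : P = localGibbsMeasure σ (fun _ => a) (fun _ => ubar) (fun _ => θ) N :=
    localGibbsLaw_eq _ _ _ _ _ _
  set R : ℝ≥0∞ := ENNReal.ofReal (16 * ((N : ℝ) + 1) ^ 2 * (hsDiameter σ N) ^ 2 * τ) * m₁ with hR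
  -- window sets at the dyadic scales
  have hwin : ∀ m : ℕ, ∃ B : Set (Config (N + 1) (Fin 3) T3), MeasurableSet B ∧
      P B ≤ ENNReal.ofReal (16 * ((N : ℝ) + 1) ^ 2 * (hsDiameter σ N) ^ 2 * (τ / 2 ^ m)) * m₁ ∧
      ∀ z ∈ hardSphereDomain (Torus.geometry (Fin 3)) (N + 1) (hsDiameter σ N), ∀ i j : Fin (N + 1), i ≠ j →
        ∀ t ∈ Icc 0 (τ / 2 ^ m),
          Torus.euclidDist ((z i).1 + Torus.proj (t • (z i).2)) ((z j).1 + Torus.proj (t • (z j).2)) =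
            (hsDiameter σ N) → z ∈ B := by
    intro m
    rw [hPeq]
    exact exists_windowSet ha hθ ubar hσ hσ4 N (h := τ / 2 ^ m) (by positivity)
  choose B hBm hBP hBmem using hwin
  -- dyadic counts
  set c : ℕ → Config (N + 1) (Fin 3) T3 → ℝ≥0∞ := fun m z =>
    ∑ k ∈ Finset.range (2 ^ m), (Φ.flow (k * (τ / 2 ^ m)) ⁻¹' B m).indicator 1 z with hc
  have hcmk : ∀ m (k : ℕ), Measurable fun z : Config (N + 1) (Fin 3) T3 =>
      (Φ.flow (k * (τ / 2 ^ m)) ⁻¹' B m).indicator (1 : Config (N + 1) (Fin 3) T3 → ℝ≥0∞) z :=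
    fun m k => measurable_one.indicator ((hBm m).preimage (Φ.measurable_flow _))
  have hcm : ∀ m, Measurable (c m) := fun m => Finset.measurable_sum _ fun k _ => hcmk m k
  -- (i) the mean of each count is at most `R`
  have hmean : ∀ m, ∫⁻ z, c m z ∂P ≤ R := by
    intro m
    simp only [hc]
    rw [lintegral_finsetSum _ fun k _ => hcmk m k]
    have hk : ∀ k ∈ Finset.range (2 ^ m),
        ∫⁻ z, (Φ.flow (k * (τ / 2 ^ m)) ⁻¹' B m).indicator 1 z ∂P = P (B m) := by
      intro k _
      rw [lintegral_indicator_one ((hBm m).preimage (Φ.measurable_flow _)), hP,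
        localGibbsLaw_const_preimage_flow σ a θ ubar N Φ _ (hBm m)]
    rw [Finset.sum_congr rfl hk, Finset.sum_const, Finset.card_range, nsmul_eq_mul]
    calc ((2 ^ m : ℕ) : ℝ≥0∞) * P (B m)
        ≤ ((2 ^ m : ℕ) : ℝ≥0∞) *
            (ENNReal.ofReal (16 * ((N : ℝ) + 1) ^ 2 * (hsDiameter σ N) ^ 2 * (τ / 2 ^ m)) * m₁) := by
          gcongr
          exact hBP m
      _ = R := by
          rw [hR, ← mul_assoc]
          congr 1
          have h2 : ((2 ^ m : ℕ) : ℝ≥0∞) = ENNReal.ofReal ((2 : ℝ) ^ m) := by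
            rw [ENNReal.ofReal_pow (by norm_num), ENNReal.ofReal_ofNat, Nat.cast_pow, Nat.cast_ofNat]
          rw [h2, ← ENNReal.ofReal_mul (by positivity)]
          congr 1
          field_simp
  -- (ii) on the good set, the collision count is at most the liminf of the dyadic counts
  have hcount : ∀ z ∈ Φ.good,
      ((numCollisions (Torus.geometry (Fin 3)) (hsDiameter σ N) (fun s => Φ.flow s z) 0 τ : ℕ) : ℝ≥0∞) ≤
        liminf (fun m => c m z) atTop := by
    intro z hz
    have htraj : IsHardSphereTrajectory (Torus.geometry (Fin 3)) (hsDiameter σ N) (N + 1) fun s => Φ.flow s z :=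
      Φ.isTrajectory z hz
    have hfin : (collisionTimes (Torus.geometry (Fin 3)) (hsDiameter σ N) (fun s => Φ.flow s z) ∩ Icc 0 τ).Finite :=
      htraj.locFinite 0 τ
    set CT := hfin.toFinset with hCT
    have hn : numCollisions (Torus.geometry (Fin 3)) (hsDiameter σ N) (fun s => Φ.flow s z) 0 τ = CT.card :=
      htraj.numCollisions_eq 0 τ
    have hCTmem : ∀ t ∈ CT, t ∈ collisionTimes (Torus.geometry (Fin 3)) (hsDiameter σ N) (fun s => Φ.flow s z) ∧
        t ∈ Icc 0 τ := fun t ht => hfin.mem_toFinset.1 ht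
    -- a positive gap between distinct collision times
    obtain ⟨g, hg0, hgap⟩ : ∃ g : ℝ, 0 < g ∧ ∀ t ∈ CT, ∀ t' ∈ CT, t ≠ t' → g ≤ |t - t'| := by
      by_cases hne : CT.offDiag.Nonempty
      · refine ⟨CT.offDiag.inf' hne (fun p => |p.1 - p.2|), ?_, ?_⟩
        · rw [Finset.lt_inf'_iff]
          intro p hp
          rw [Finset.mem_offDiag] at hp
          exact abs_pos.2 (sub_ne_zero.2 hp.2.2)
        · intro t ht t' ht' htt'
          have hp : (t, t') ∈ CT.offDiag := Finset.mem_offDiag.2 ⟨ht, ht', htt'⟩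
          exact Finset.inf'_le (fun p : ℝ × ℝ => |p.1 - p.2|) hp
      · refine ⟨1, one_pos, fun t ht t' ht' htt' => ?_⟩
        have hp : (t, t') ∈ CT.offDiag := Finset.mem_offDiag.2 ⟨ht, ht', htt'⟩
        exact absurd ⟨(t, t'), hp⟩ hne
    -- eventually the mesh is below the gap
    obtain ⟨m₀, hm₀⟩ := exists_nat_gt (τ / g)
    have hmesh : ∀ m : ℕ, m₀ ≤ m → τ / 2 ^ m < g := by
      intro m hm
      have h2m : (m : ℝ) < 2 ^ m := by exact_mod_cast Nat.lt_two_pow_self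
      have h1 : τ / g < 2 ^ m := hm₀.trans_le ((Nat.cast_le.2 hm).trans h2m.le)
      rw [div_lt_iff₀ hg0] at h1
      rw [div_lt_iff₀ (by positivity)]
      linarith
    refine le_liminf_of_le (h := Filter.eventually_atTop.2 ⟨m₀, fun m hm => ?_⟩)
    -- counting for a fixed fine scale `m`
    set hm' : ℝ := τ / 2 ^ m with hhm
    have hh0 : 0 < hm' := by positivity
    have hhg : hm' < g := hmesh m hm
    have h2pow : ((2 ^ m - 1 : ℕ) : ℝ) + 1 = 2 ^ m := by
      have : 1 ≤ 2 ^ m := Nat.one_le_two_pow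
      rw [Nat.cast_sub this]
      push_cast
      ring
    set f : ℝ → ℕ := fun t => min ⌊t / hm'⌋₊ (2 ^ m - 1) with hf
    have hf1 : ∀ t, f t < 2 ^ m := fun t =>
      (min_le_right _ _).trans_lt (Nat.sub_lt Nat.one_le_two_pow one_pos)
    have hf2 : ∀ t, 0 ≤ t → (f t : ℝ) * hm' ≤ t := by
      intro t ht0
      have h1 : ((f t : ℕ) : ℝ) ≤ ⌊t / hm'⌋₊ := by exact_mod_cast min_le_left _ _
      calc (f t : ℝ) * hm' ≤ ⌊t / hm'⌋₊ * hm' := mul_le_mul_of_nonneg_right h1 hh0.le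
        _ ≤ t / hm' * hm' := mul_le_mul_of_nonneg_right (Nat.floor_le (by positivity)) hh0.le
        _ = t := div_mul_cancel₀ t hh0.ne'
    have hf3 : ∀ t, t ≤ τ → t ≤ ((f t : ℝ) + 1) * hm' := by
      intro t htτ
      by_cases hcase : ⌊t / hm'⌋₊ ≤ 2 ^ m - 1
      · have hft : f t = ⌊t / hm'⌋₊ := min_eq_left hcase
        rw [hft]
        have := Nat.lt_floor_add_one (t / hm')
        rw [div_lt_iff₀ hh0] at this
        exact this.le
      · have hft : f t = 2 ^ m - 1 := min_eq_right (le_of_not_ge hcase)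
        rw [hft, h2pow, hhm, mul_div_cancel₀ τ (by positivity)]
        exact htτ
    -- every collision time of `[0, τ]` marks an occupied window
    have hhit : ∀ t ∈ CT, Φ.flow (f t * hm') z ∈ B m := by
      intro t ht
      obtain ⟨htc, ht0, htτ⟩ := hCTmem t ht
      have hwD : Φ.flow (f t * hm') z ∈ hardSphereDomain (Torus.geometry (Fin 3)) (N + 1) (hsDiameter σ N) :=
        Φ.good_subset (Φ.mapsTo_good _ hz)
      obtain ⟨i, j, hij, s, hs, hdist⟩ := exists_freeFlight_contact_of_collision_shift Φ hz
        (a := f t * hm') (h := hm') ⟨hf2 t ht0, by linarith [hf3 t htτ]⟩ htc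
      exact hBmem m _ hwD i j hij s hs hdist
    have hinj : Set.InjOn f CT := by
      intro t ht t' ht' hff
      by_contra htt'
      have hle : g ≤ |t - t'| := hgap t ht t' ht' htt'
      obtain ⟨-, ht0, htτ⟩ := hCTmem t ht
      obtain ⟨-, ht0', htτ'⟩ := hCTmem t' ht'
      have h1 := hf2 t ht0
      have h2 := hf3 t htτ
      have h3 := hf2 t' ht0'
      have h4 := hf3 t' htτ'
      rw [hff] at h1 h2
      have habs : |t - t'| ≤ hm' := by
        rw [abs_le]
        constructor <;> nlinarith
      linarith
    -- the count at scale `m` is at least the number of collision times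
    calc ((numCollisions (Torus.geometry (Fin 3)) (hsDiameter σ N) (fun s => Φ.flow s z) 0 τ : ℕ) : ℝ≥0∞)
        = (CT.image f).card := by rw [hn, Finset.card_image_of_injOn hinj]
      _ = ∑ k ∈ CT.image f, (1 : ℝ≥0∞) := by simp
      _ = ∑ k ∈ CT.image f, (Φ.flow (k * hm') ⁻¹' B m).indicator 1 z := by
          refine Finset.sum_congr rfl fun k hk => ?_
          obtain ⟨t, ht, rfl⟩ := Finset.mem_image.1 hk
          rw [indicator_of_mem (show z ∈ Φ.flow (f t * hm') ⁻¹' B m from hhit t ht)]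
          rfl
      _ ≤ ∑ k ∈ Finset.range (2 ^ m), (Φ.flow (k * hm') ⁻¹' B m).indicator 1 z := by
          refine Finset.sum_le_sum_of_subset_of_nonneg (fun k hk => ?_) fun _ _ _ => bot_le
          obtain ⟨t, -, rfl⟩ := Finset.mem_image.1 hk
          exact Finset.mem_range.2 (hf1 t)
      _ = c m z := by simp only [hc, hhm]
  -- (iii) Fatou
  refine ⟨fun z => liminf (fun m => c m z) atTop, Measurable.liminf hcm, hcount, ?_⟩
  exact (lintegral_liminf_le hcm).trans (liminf_le_of_frequently_le (Eventually.of_forall hmean).frequently)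

/-- **Mean collision number of the dilute hard-sphere gas on `𝕋³` in equilibrium** (mean-free-time
bound): under the homogeneous Gibbs law, for every hard-sphere flow and `τ > 0`,
`∫ #{collision times in [0, τ]} dG_N ≤ 16 (N+1)² ε_N² τ · E_γ‖w − ū‖ = 16 σ² (N+1)^{4/3} τ E‖w − ū‖`
(`a, θ > 0`, `0 < σ ≤ 1/4`; lower Lebesgue integral of the — possibly non-measurable — count, which is
dominated on the `G_N`-conull good set by the majorant of `exists_collision_majorant`). [folklore] -/
theorem lintegral_numCollisions_le_const {a θ : ℝ} (ha : 0 < a) (hθ : 0 < θ) (ubar : V3) {σ : ℝ}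
    (hσ : 0 < σ) (hσ4 : σ ≤ 1 / 4) (N : ℕ)
    (Φ : HardSphereFlow (Torus.geometry (Fin 3)) (hsDiameter σ N) (N + 1)) {τ : ℝ} (hτ : 0 < τ) :
    ∫⁻ z, ((numCollisions (Torus.geometry (Fin 3)) (hsDiameter σ N) (fun s => Φ.flow s z) 0 τ : ℕ) :
        ℝ≥0∞) ∂(localGibbsLaw σ (fun _ => a) (fun _ => ubar) (fun _ => θ) N Φ) ≤
      ENNReal.ofReal (16 * ((N : ℝ) + 1) ^ 2 * hsDiameter σ N ^ 2 * τ) *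
        ∫⁻ w, ‖w - ubar‖ₑ ∂gaussMeasure ubar θ := by
  obtain ⟨F, -, hFge, hFint⟩ := exists_collision_majorant ha hθ ubar hσ hσ4 N Φ hτ
  refine (lintegral_mono_ae ?_).trans hFint
  have hgood : ∀ᵐ z ∂(localGibbsLaw σ (fun _ => a) (fun _ => ubar) (fun _ => θ) N Φ), z ∈ Φ.good := by
    rw [localGibbsLaw_eq]
    exact (localGibbsMeasure_absolutelyContinuous σ _ _ _ N Φ).ae_le Φ.ae_mem_good
  filter_upwards [hgood] with z hz using hFge z hz

/-- **Collision tightness at rung 0 (constant profiles).** For activity `a > 0`, drift `ū` and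
temperature `θ > 0`, every reduced density `0 < σ < 1/4`, every family of hard-sphere flows `Φ_N`,
every horizon `τ > 0` and every `δ > 0` there is `K` with
`G_N{z | K < ε_N (N+1)⁻¹ · #{collisions of the orbit of z in [0, τ]}} ≤ δ` for EVERY `N`, where
`G_N = localGibbsLaw σ a ū θ N Φ_N` is the homogeneous (flow-invariant) Gibbs law — VERBATIM the body
of `JParityClosure.CollisionTightness` with the three profiles specialised to constants.  Proof:
Markov's inequality for the majorant of `exists_collision_majorant` and `(N+1) ε_N³ = σ³`:
`G_N{K < X_N} ≤ 16 σ³ τ E‖w−ū‖ / K`, so `K = 16 σ³ τ E‖w−ū‖/δ + 1` works uniformly in `N`.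
[folklore] -/
theorem collisionTightness_const {a θ : ℝ} (ha : 0 < a) (hθ : 0 < θ) (ubar : V3) :
    ∃ σ₀ : ℝ, 0 < σ₀ ∧ ∀ σ : ℝ, 0 < σ → σ < σ₀ →
      ∀ Φ : (N : ℕ) → HardSphereFlow (Torus.geometry (Fin 3)) (hsDiameter σ N) (N + 1),
      ∀ τ : ℝ, 0 < τ → ∀ δ : ℝ, 0 < δ → ∃ K : ℝ, ∃ N₀ : ℕ, ∀ N : ℕ, N₀ ≤ N →
        localGibbsLaw σ (fun _ => a) (fun _ => ubar) (fun _ => θ) N (Φ N)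
          {z | K < hsDiameter σ N / (N + 1 : ℝ) *
            (numCollisions (Torus.geometry (Fin 3)) (hsDiameter σ N)
              (fun s => (Φ N).flow s z) 0 τ : ℝ)} ≤ ENNReal.ofReal δ := by
  refine ⟨1 / 4, by norm_num, fun σ hσ hσ4 Φ τ hτ δ hδ => ?_⟩
  set m₁ : ℝ≥0∞ := ∫⁻ w, ‖w - ubar‖ₑ ∂gaussMeasure ubar θ with hm₁
  have hm₁top : m₁ ≠ ⊤ := (lintegral_enorm_sub_gaussMeasure_lt_top ubar θ).ne
  set K : ℝ := 16 * σ ^ 3 * τ * m₁.toReal / δ + 1 with hK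
  have hK0 : 0 < K := by positivity
  refine ⟨K, 0, fun N _ => ?_⟩
  set ε := hsDiameter σ N with hε
  have hε0 : 0 < ε := hsDiameter_pos hσ N
  set P := localGibbsLaw σ (fun _ => a) (fun _ => ubar) (fun _ => θ) N (Φ N) with hP
  have hPeq : P = localGibbsMeasure σ (fun _ => a) (fun _ => ubar) (fun _ => θ) N :=
    localGibbsLaw_eq _ _ _ _ _ _
  set R : ℝ≥0∞ := ENNReal.ofReal (16 * ((N : ℝ) + 1) ^ 2 * ε ^ 2 * τ) * m₁ with hR
  obtain ⟨F, hF, hFge, hFint⟩ := exists_collision_majorant ha hθ ubar hσ hσ4.le N (Φ N) hτ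
  set L : ℝ := K * ((N : ℝ) + 1) / ε with hL
  have hL0 : 0 < L := by positivity
  have hgood0 : P (Φ N).goodᶜ = 0 := by
    rw [hPeq]
    exact localGibbsMeasure_absolutelyContinuous σ _ _ _ N (Φ N) (Φ N).measure_compl_good
  have hsub : {z : Config (N + 1) (Fin 3) T3 | K < ε / (N + 1 : ℝ) *
        (numCollisions (Torus.geometry (Fin 3)) ε (fun s => (Φ N).flow s z) 0 τ : ℝ)} ⊆
      {z | ENNReal.ofReal L ≤ F z} ∪ (Φ N).goodᶜ := by
    intro z hzT
    by_cases hzg : z ∈ (Φ N).good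
    · left
      have hKlt : K < ε / (N + 1 : ℝ) *
          (numCollisions (Torus.geometry (Fin 3)) ε (fun s => (Φ N).flow s z) 0 τ : ℝ) := hzT
      have hLlt : L ≤ (numCollisions (Torus.geometry (Fin 3)) ε (fun s => (Φ N).flow s z) 0 τ : ℝ) := by
        have hcpos : (0 : ℝ) < ε / ((N : ℝ) + 1) := by positivity
        have h1 : K / (ε / ((N : ℝ) + 1)) <
            (numCollisions (Torus.geometry (Fin 3)) ε (fun s => (Φ N).flow s z) 0 τ : ℝ) :=
          (div_lt_iff₀' hcpos).2 hKlt
        rw [div_div_eq_mul_div] at h1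
        rw [hL]
        exact h1.le
      calc ENNReal.ofReal L
          ≤ ENNReal.ofReal (numCollisions (Torus.geometry (Fin 3)) ε (fun s => (Φ N).flow s z) 0 τ : ℝ) :=
            ENNReal.ofReal_le_ofReal hLlt
        _ = ((numCollisions (Torus.geometry (Fin 3)) ε (fun s => (Φ N).flow s z) 0 τ : ℕ) : ℝ≥0∞) :=
            ENNReal.ofReal_natCast _
        _ ≤ F z := hFge z hzg
    · right
      exact hzg
  have hε3 : ((N : ℝ) + 1) * ε ^ 3 = σ ^ 3 := by
    have h := succ_mul_hsDiameter_pow_three σ N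
    push_cast at h
    exact h
  calc P {z : Config (N + 1) (Fin 3) T3 | K < ε / (N + 1 : ℝ) *
        (numCollisions (Torus.geometry (Fin 3)) ε (fun s => (Φ N).flow s z) 0 τ : ℝ)}
      ≤ P ({z | ENNReal.ofReal L ≤ F z} ∪ (Φ N).goodᶜ) := measure_mono hsub
    _ ≤ P {z | ENNReal.ofReal L ≤ F z} + P (Φ N).goodᶜ :=
        measure_union_le _ _
    _ = P {z | ENNReal.ofReal L ≤ F z} := by rw [hgood0, add_zero]
    _ ≤ (∫⁻ z, F z ∂P) / ENNReal.ofReal L :=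
        meas_ge_le_lintegral_div hF.aemeasurable (ENNReal.ofReal_pos.2 hL0).ne' ENNReal.ofReal_ne_top
    _ ≤ R / ENNReal.ofReal L := ENNReal.div_le_div_right hFint _
    _ ≤ ENNReal.ofReal δ := by
        rw [ENNReal.div_le_iff (ENNReal.ofReal_pos.2 hL0).ne' ENNReal.ofReal_ne_top]
        have hm0 : 0 ≤ m₁.toReal := ENNReal.toReal_nonneg
        have hKδ : δ * (K * ((N : ℝ) + 1) / ε) =
            (16 * σ ^ 3 * τ * m₁.toReal + δ) * ((N : ℝ) + 1) / ε := by
          rw [hK]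
          field_simp
        have hreal : 16 * ((N : ℝ) + 1) ^ 2 * ε ^ 2 * τ * m₁.toReal ≤ δ * L := by
          rw [hL, hKδ, le_div_iff₀ hε0]
          calc 16 * ((N : ℝ) + 1) ^ 2 * ε ^ 2 * τ * m₁.toReal * ε
              = 16 * σ ^ 3 * τ * m₁.toReal * ((N : ℝ) + 1) := by rw [← hε3]; ring
            _ ≤ (16 * σ ^ 3 * τ * m₁.toReal + δ) * ((N : ℝ) + 1) := by
                have hN1 : (0 : ℝ) ≤ (N : ℝ) + 1 := by positivity
                nlinarith
        calc R = ENNReal.ofReal (16 * ((N : ℝ) + 1) ^ 2 * ε ^ 2 * τ * m₁.toReal) := by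
              rw [hR, ← ENNReal.ofReal_toReal hm₁top, ENNReal.toReal_ofReal hm0,
                ← ENNReal.ofReal_mul (by positivity)]
          _ ≤ ENNReal.ofReal (δ * L) := ENNReal.ofReal_le_ofReal hreal
          _ = ENNReal.ofReal δ * ENNReal.ofReal L := ENNReal.ofReal_mul hδ.le

end Summit.AtomisticToContinuum.HydrodynamicLimit.Theorems

end
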